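import Summits.RiemannHypothesis.RiemannHypothesis.Theorems.TiltedLandingLaw421R3RateGlue2A

/-!
# Touched-level dissipation — C′ MODULE (v4 = the LANDING CUT of `TouchedDissipation-v3opt.lean` bfd0f370067913f7, per (CA638)(B); lens-2 g6)
File 1 of the RUNG-P pair.  CONTENT = v3opt's LIVE declarations, TOKEN-IDENTICAL: §1 the objects `Touches`, `AtomicPair`, `pairUnion` (`Ū = D̄_v ∪ D̄_z`),
`childEnergy` (multiplicity-weighted energy of the upper children of `f⁽ʲ⁺¹⁾` off `Z(f⁽ʲ⁾)` in a set), `stateKappa` (`κ_v = ‖tiltAt f j v‖`); §2 the typed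
law C′ = `TouchedDissipationLawQ c κ₀` («on a charged APPROACH level whose lowest band state `v` is touched by a strictly taller `z`, the pair atomic,
`κ₀ ≤ Im v·κ_v`: `c ≤ ((Im v² + Im z²) − childEnergy(Ū))·κ_v²`») and its ∃-form `TouchedDissipationLawQEx`; §3 three bookkeeping lemmas (instance ⇒ ∃,
monotonicity in `(c, κ₀)`, `childEnergy ≥ 0`).  EXCISED (dead history, never to land): the `s`-currency law T″ `TouchedDissipationLawSQ` (DEAD AS TYPED,
CUT 26 WFar(b), (CA627)) with its §3b, and the Γ1-cap conversions `sCurrency_of_dimensionless` / `sCurrency_at_level` (Γ1 `StateCapLawQ` DEAD, CUT 25).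
STATUS: C′ is a TYPED LAW, NOT PROVED and NOT instantiated here (no theorem of this file has `TouchedDissipationLawQ c κ₀` as a conclusion for numeric
`c, κ₀`); RUNG-P (`RhW08.PerturbativeRung.RungP = TouchedDissipationLawQ (5/2) 30`, file 2) is its perturbative instance, a CANDIDATE.  Record (crit-1
CUT 16–30, instr-1 T-PRICE-v2): min X = ΔE·κ_v² over 150 300 + 53 868 legal charged approach β-rows = 2.90 (floor λ ≥ 3) / 3.06 (λ ≥ 30); no row below 5/2
above λ = 30.  Nothing here bears on the truth of RH; RH is not proved; ★A / 33346 / 33347 OPEN; checked ≠ landed ≠ proved. -/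
namespace RhW08.TouchedDissipation

open Complex
open scoped ComplexConjugate
open RhW08.Round1 RhW08.StSwap RhW08.Round2 RhW08.QuadW
open RhW08.SealSwap (PBot)
open RhW08.SealSwapQ RhW08.RateSplit RhW08.BurgersRate RhW08.BurgersRateG3
open RhIdea6.G17.W07C7 RhIdea6.G17.W07C7.Rev6 RhIdea6.G18.W07C8.Law421BirthS RhIdea6.G19.W07C11.Seam
open RhIdea6.G20.W07C12.Frac RhIdea6.G20.W07C12.StColP RhW07.C12.FieldSplit RhIdea6.G21.W07C13.TentMax
open RhW07.C14.TwoSided RhW07.C14.Classes RhW07.C14.Lineage RhW07.C14.Booking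

/-! ## §1 Objects (expressions in `iteratedDeriv`; no structure, no instance) -/

/-- §1 the TOUCH relation at level `j`: `z` is a zero of `f⁽ʲ⁾` STRICTLY TALLER than `v` whose closed axis-centred Jensen disc meets `v`'s —
`Im v < Im z ∧ |Re v − Re z| ≤ Im v + Im z` (the negation instance of R1a′'s separation binder C′ in `FarChildExistsLawSep`). -/
def Touches (f : ℂ → ℂ) (j : ℕ) (v z : ℂ) : Prop :=
  iteratedDeriv j f z = 0 ∧ v.im < z.im ∧ |v.re - z.re| ≤ v.im + z.im

/-- §1 the pair is ATOMIC at level `j`: every OTHER upper zero `u` of `f⁽ʲ⁾` is disc-separated from both `v` and `z`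
(`Im · + Im u < |Re · − Re u|`), i.e. the cluster of `v` is exactly `{v, z}` (W1's `P = 2`; lens-1's atomic two-pair class). -/
def AtomicPair (f : ℂ → ℂ) (j : ℕ) (v z : ℂ) : Prop :=
  ∀ u : ℂ, iteratedDeriv j f u = 0 → 0 < u.im → u ≠ v → u ≠ z → v.im + u.im < |v.re - u.re| ∧ z.im + u.im < |z.re - u.re|

/-- §1 the closed two-disc union `Ū = D̄_v ∪ D̄_z` of the axis-centred Jensen discs (`‖u − Re v‖ ≤ Im v` or `‖u − Re z‖ ≤ Im z`). -/
def pairUnion (v z : ℂ) : Set ℂ :=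
  {u : ℂ | ‖u - (v.re : ℂ)‖ ≤ v.im ∨ ‖u - (z.re : ℂ)‖ ≤ z.im}

/-- §1 the multiplicity-weighted ENERGY OF THE UPPER CHILDREN of `f⁽ʲ⁺¹⁾` off `Z(f⁽ʲ⁾)` inside a set `S`:
`Σᶠ_{u ∈ S, f⁽ʲ⁺¹⁾ u = 0, f⁽ʲ⁾ u ≠ 0, Im u > 0} ord(u)·Im u²` (the population W1 counts; `finsum` reads `0` on an infinite support, which a legal frame
never has). -/
noncomputable def childEnergy (f : ℂ → ℂ) (j : ℕ) (S : Set ℂ) : ℝ :=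
  ∑ᶠ u ∈ {u : ℂ | (iteratedDeriv (j + 1) f u = 0 ∧ iteratedDeriv j f u ≠ 0 ∧ u ∈ S) ∧ 0 < u.im},
    (analyticOrderNatAt (iteratedDeriv (j + 1) f) u : ℝ) * u.im ^ 2

/-- §1 the STATE FIELD MODULUS `κ_v := ‖tiltAt f j v‖` — the field the other zeros (partner `v̄` excluded) and the exponential factor exert AT the state
(`RhW08.BurgersRate.tiltAt` = `newtonK + i/(2·Im v)`; the column's κ_book). -/
noncomputable def stateKappa (f : ℂ → ℂ) (j : ℕ) (v : ℂ) : ℝ := ‖tiltAt f j v‖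

/-! ## §2 The law -/

/-- (LAW T′ = C′ — TOUCHED-LEVEL DISSIPATION ON APPROACH LEVELS; typed, OPEN; dimensionless; parameters `c` = dissipation constant, `κ₀` = floor)
on a legal frame, at a CHARGED APPROACH level `j` (`ApproachLevelQ`: neither far nor consumption — v2's added binder) with lowest band state `v` touched by a strictly taller zero `z` (`Touches`), the pair atomic (`AtomicPair`) and the state field above
the floor (`κ₀ ≤ Im v·κ_v`): the pair energy `Im v² + Im z²` exceeds the energy of the upper children of `f⁽ʲ⁺¹⁾` off `Z(f⁽ʲ⁾)` in `Ū = D̄_v ∪ D̄_z`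
(multiplicity-weighted) by at least `c/κ_v²`.  Column (instr-1): κ_book²·ΔE on touched charged levels by regime of κ·Im v; kill `> −c` above the floor. -/
def TouchedDissipationLawQ (c κ₀ : ℝ) : Prop :=
  ∀ (η : ℝ) (f : ℂ → ℂ) (x₀ s hmax R Hs : ℝ) (B : ℕ), EngineHyps5 2 η f x₀ s hmax R Hs B →
    ∀ (j : ℕ) (v z : ℂ), Charged (PTrkSQ PBot) StTrkDQ ReadyR2 η f x₀ s hmax R Hs B j → ApproachLevelQ η f x₀ s hmax R Hs B j →
      IsLowest StTrkDQ η f x₀ s hmax R Hs B j v → Touches f j v z → AtomicPair f j v z →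
      κ₀ ≤ v.im * stateKappa f j v →
      c ≤ ((v.im ^ 2 + z.im ^ 2) - childEnergy f j (pairUnion v z)) * stateKappa f j v ^ 2

/-- (LAW T-∃ — the constants EXISTENTIAL; typing checklist (iv)) some admissible `(c, κ₀)` — `1 ≤ c` («at least one isolated pair's rate») and
`0 < κ₀` — satisfies `TouchedDissipationLawQ c κ₀`.  Record candidates against the column: `(1, 2)`, `(1, 3)`; the first-order asymptote is `c = 3`. -/
def TouchedDissipationLawQEx : Prop :=
  ∃ c κ₀ : ℝ, 1 ≤ c ∧ 0 < κ₀ ∧ TouchedDissipationLawQ c κ₀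


/-! ## §3 Bookkeeping (K) -/

/-- (K) §3 any admissible instance gives the existential form. -/
theorem touchedDissipationLawQEx_of_instance {c κ₀ : ℝ} (hc : 1 ≤ c) (hκ : 0 < κ₀) (h : TouchedDissipationLawQ c κ₀) :
    TouchedDissipationLawQEx :=
  ⟨c, κ₀, hc, hκ, h⟩

/-- (K) §3 the law is DOWNWARD-closed in the constant and UPWARD-closed in the floor: `c′ ≤ c`, `κ₀ ≤ κ₀′` ⇒ `T c κ₀ → T c′ κ₀′`. -/
theorem touchedDissipationLawQ_mono {c c' κ₀ κ₀' : ℝ} (hc : c' ≤ c) (hκ : κ₀ ≤ κ₀') (h : TouchedDissipationLawQ c κ₀) :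
    TouchedDissipationLawQ c' κ₀' :=
  fun η f x₀ s hmax R Hs B hE j v z hch hA hlow ht ha hfl =>
    hc.trans (h η f x₀ s hmax R Hs B hE j v z hch hA hlow ht ha (hκ.trans hfl))

/-- (K) §3 the child energy is non-negative. -/
theorem childEnergy_nonneg (f : ℂ → ℂ) (j : ℕ) (S : Set ℂ) : 0 ≤ childEnergy f j S :=
  finsum_nonneg fun u => finsum_nonneg fun _ => by positivity

end RhW08.TouchedDissipation
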